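import Summits.BirchSwinnertonDyer.BirchSwinnertonDyer.Theorems.Rank1ResidualJetThm63LocalInputs
import HarnessLib

/-!
# The walk's duality inputs `hC`, `hdual_q`, `hdual_ℓ` (and the carrier) FROM bsd-jet's Poitou–Tate
# packages (`GlobalDuality.exists_rowDuality`), at every admissible conductor at once (cell `bsd-stepL`,
# seat `bsd-stepL-tam3-p1`, helper toward item 19109 `EulerHalvesAtThree`, registered stub
# `stub_jetchevMaxHLAtThree`)

HONEST FRAMING. Nothing here proves BSD, J₃ or any divisibility of a Heegner point; the registered stub
is NOT discharged; no item closes; 0 classes move (T7); `--supports stmt-BirchSwinnertonDyer-19109`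
(helper). WHAT THIS FILE DOES. The two programmes COMPOSE: the conjuncts `hC`, `hdual_q`, `hdual_ℓ` of
the supply displays `Koly.jetchevMaxHLAtThree_of_facts_of_{supply, orderedSupply, baseSupply}` (this
seat; [J] Thm 5.1 at the carrier pair + (δ), and Lemma 5.2 (iii) at the Kolyvagin primes, in the
∃-shapes of the kernel walk) are exactly the conclusions of bsd-jet pv-1's `GlobalDuality.exists_rowDuality`
(p506535) read at the conductor `s` and the sign `−ε(s)`; `Walk.exists_dualityConjuncts_of_rowDuality`
chooses the dual modules `C'(m)` over all admissible conductors `m` at once (`⊥` off the admissible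
ones) and returns the three conjuncts VERBATIM (general `p`; carrier `Qcar := {v₀, τ • v₀}`), from
bsd-jet's standing inputs: the named print fact `poitouTate_selmerStructure_duality_conj K` (Poitou–Tate
for Selmer structures), a `τ`-equivariant Weil datum `e`, and LOCAL inputs at single completions — `𝒯`
`τ`-stable and self-dual at the primes of each admissible conductor (`h𝒯σ`, `h𝒯sd`), `𝒮 ≤ Kum` and
`τ`-stable at the carrier pair (`hS`, `h𝒮σ`), (δ) `Kum_{v₀}/𝒮_{v₀}` cyclic of order `p^t` (`hcyc`,
`hidx`), Lemma 5.2 (i)–(ii) at the Kolyvagin primes for both signs (`hloc`); the carrier place `v₀` lies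
over the conductor `N` and is moved by `τ` (`hv₀N`, `hv₀`: `N` splits in `K`). The disjointness of the
carrier pair from the primes of an admissible conductor is derived (Kolyvagin primes are prime to `N`),
as in bsd-jet's `JET.tamagawaExponent_le_mInfty_of_localInputs`.
References (locators only; no cited FACT declared): [cite: Jetchev2008, Thm. 5.1, Lemma 5.2 (i)–(iii),
proof of Thm. 5.2 (pp. 821–823)] [cite: MilneADT2006, Ch. I, Thm. 4.10(b)] [cite: SilvermanAEC2009,
Prop. III.8.1] [cite: WZhang2014, Notations (xii)]. Design: one theorem, no definitions; `K : Type`.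
Axioms: `propext`, `Classical.choice`, `Quot.sound`.
-/

set_option autoImplicit false

noncomputable section

open scoped Classical Pointwise
open Function NumberField IsDedekindDomain WeierstrassCurve Field
open Literature.NumberTheory.EllipticCurves Literature.NumberTheory.GaloisRepresentations
open Literature.NumberTheory.EllipticCurves.Jetchev2008
open Literature.NumberTheory.GaloisCohomology Literature.NumberTheory.Automorphic
open Literature.NumberTheory.GaloisRepresentations.DiscreteGaloisModule (localTatePairingZMod
  tateDual SelmerStructure)
open Summit.BirchSwinnertonDyer.Rank1Residual.JET.SelmerVocabulary
open Literature.NumberTheory.NumberFields.Honda1971 (natCast_notMem_of_coprime)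

namespace Summit.BirchSwinnertonDyer.Rank1Residual.JET.Walk

variable {K : Type} [Field K] [NumberField K] (W : WeierstrassCurve ℚ) [W.IsElliptic]
  [W.IsGloballyMinimal]
  (τ : K ≃ₐ[ℚ] K) (p k : ℕ) [Fact p.Prime] [NeZero (p ^ k)]
  [Finite (geomTorsion (W.baseChange K) ((p ^ k : ℕ) : ℤ))]
  (e : geomTorsion (W.baseChange K) ((p ^ k : ℕ) : ℤ) → geomTorsion (W.baseChange K) ((p ^ k : ℕ) : ℤ) →
    AlgebraicClosure K)
  (hμ : ∀ S T, e S T ^ (p ^ k) = 1)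
  (hadd₁ : ∀ S₁ S₂ T, e (S₁ + S₂) T = e S₁ T * e S₂ T)
  (hadd₂ : ∀ S T₁ T₂, e S (T₁ + T₂) = e S T₁ * e S T₂)
  (hgal : ∀ (g : absoluteGaloisGroup K) (S T : geomTorsion (W.baseChange K) ((p ^ k : ℕ) : ℤ)),
    g • e S T = e (g • S) (g • T))
  (halt : ∀ T, e T T = 1) (hnondeg : ∀ T, (∀ S, e S T = 1) → T = 0)
  (hτe : ∀ S T, liftAut τ (e S T) =
    e ((isLiftOfAut_liftAut τ).torsionMap W ((p ^ k : ℕ) : ℤ) S)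
      ((isLiftOfAut_liftAut τ).torsionMap W ((p ^ k : ℕ) : ℤ) T))

include halt hnondeg hτe in
/-- **The supply's `hC` ∧ `hdual_q` ∧ `hdual_ℓ` from bsd-jet's Poitou–Tate packages, at all admissible
conductors at once** (carrier `Qcar := {v₀, τ • v₀}`, sign `−ε(m) = if ¬eb m then 1 else −1`, dual
modules `C'(m)` chosen per conductor). The conclusions are the three conjuncts of
`Koly.jetchevMaxHLAtThree_of_facts_of_baseSupply` VERBATIM at a general prime `p` (base conductor `n`;
the premises `n ∣ s`, `ℓ` above `s` of the based form are accepted and not used).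
[cite: Jetchev2008, Thm. 5.1, Lemma 5.2, proof of Thm. 5.2 (pp. 821–823)]
[cite: MilneADT2006, Ch. I, Thm. 4.10(b)] -/
theorem exists_dualityConjuncts_of_rowDuality (hPT : poitouTate_selmerStructure_duality_conj K)
    (hτ : τ * τ = 1) (hp2 : p ≠ 2) (hk : 1 ≤ k)
    (𝒯 𝒮 : SelmerStructure ((W.baseChange K).torsionGaloisModule ((p ^ k : ℕ) : ℤ)))
    (eb : ℕ → Bool) (n : ℕ)
    (h𝒯σ : ∀ (s : {m : ℕ // Squarefree m ∧ ∀ q ∈ m.primeFactors,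
        Zhang2014.IsKolyvaginPrime (W.conductorNorm ℤ) W K p q ∧ k ≤ Zhang2014.kolyvaginIndex W p q})
      (v w : HeightOneSpectrum (𝓞 K)) (h : τ • v = w), v ∈ placesDividing K s.1 →
      ∀ x : galoisCohomology (((W.baseChange K).torsionGaloisModule ((p ^ k : ℕ) : ℤ)).toLocal
        (Sum.inr v : Place K)) 1,
      x ∈ 𝒯 (Sum.inr v) → conjActPlace W τ ((p ^ k : ℕ) : ℤ) h x ∈ 𝒯 (Sum.inr w))
    (h𝒯sd : ∀ (s : {m : ℕ // Squarefree m ∧ ∀ q ∈ m.primeFactors,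
        Zhang2014.IsKolyvaginPrime (W.conductorNorm ℤ) W K p q ∧ k ≤ Zhang2014.kolyvaginIndex W p q})
      (inv : LocalInvariants K (p ^ k)), inv.IsPerfect → ∀ v ∈ placesDividing K s.1,
      inv.dualTransported 𝒯 (weilDualIntertwining (W.baseChange K) (p ^ k) e hμ hadd₁ hadd₂ hgal)
        (Sum.inr v) = 𝒯 (Sum.inr v))
    (hS : ∀ v, 𝒮 v ≤ (W.baseChange K).kummerSelmerStructure ((p ^ k : ℕ) : ℤ) v)
    (v₀ : HeightOneSpectrum (𝓞 K)) (hv₀ : τ • v₀ ≠ v₀)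
    (hv₀N : ((W.conductorNorm ℤ : ℕ) : 𝓞 K) ∈ v₀.asIdeal)
    (h𝒮σ : ∀ (v w : HeightOneSpectrum (𝓞 K)) (h : τ • v = w), v ∈ ({v₀, τ • v₀} : Finset _) →
      ∀ x : galoisCohomology (((W.baseChange K).torsionGaloisModule ((p ^ k : ℕ) : ℤ)).toLocal
        (Sum.inr v : Place K)) 1,
      x ∈ 𝒮 (Sum.inr v) → conjActPlace W τ ((p ^ k : ℕ) : ℤ) h x ∈ 𝒮 (Sum.inr w))
    {t : ℕ}
    (hcyc : IsAddCyclic (↥((W.baseChange K).kummerSelmerStructure ((p ^ k : ℕ) : ℤ) (Sum.inr v₀)) ⧸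
      (𝒮 (Sum.inr v₀)).addSubgroupOf
        ((W.baseChange K).kummerSelmerStructure ((p ^ k : ℕ) : ℤ) (Sum.inr v₀))))
    (hidx : (𝒮 (Sum.inr v₀)).relIndex
      ((W.baseChange K).kummerSelmerStructure ((p ^ k : ℕ) : ℤ) (Sum.inr v₀)) = p ^ t)
    (hloc : ∀ ℓ : ℕ, Zhang2014.IsKolyvaginPrime (W.conductorNorm ℤ) W K p ℓ →
      k ≤ Zhang2014.kolyvaginIndex W p ℓ →
      ∀ (v : HeightOneSpectrum (𝓞 K)), (ℓ : 𝓞 K) ∈ v.asIdeal → ∀ (hfix : τ • v = v)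
        (s : ℤ), s = 1 ∨ s = -1 →
      ((W.baseChange K).kummerSelmerStructure ((p ^ k : ℕ) : ℤ) (Sum.inr v)).relIndex
        ((conjActPlace W τ ((p ^ k : ℕ) : ℤ) hfix - s • AddMonoidHom.id _).ker) = p ^ k) :
    ∃ C' : ℕ → AddSubgroup (galoisCohomology ((W.baseChange K).torsionGaloisModule ((p ^ k : ℕ) : ℤ)) 1),
      (∀ m, C' m ≤ signPart W K τ ((p ^ k : ℕ) : ℤ) (if !eb m then 1 else -1) ⊤) ∧
      (∀ s : {m : ℕ // Squarefree m ∧ ∀ q ∈ m.primeFactors,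
          Zhang2014.IsKolyvaginPrime (W.conductorNorm ℤ) W K p q ∧ k ≤ Zhang2014.kolyvaginIndex W p q},
        n ∣ s.1 → ∃ (Qg Qg' : Type) (_ : AddCommGroup Qg) (_ : AddCommGroup Qg') (_ : Finite Qg')
          (locq : signPart W K τ ((p ^ k : ℕ) : ℤ) (if !eb s.1 then 1 else -1)
              (selmerF W ((p ^ k : ℕ) : ℤ) 𝒯 (placesDividing K s.1)).selmerGroup →+ Qg)
          (locq' : C' s.1 →+ Qg'),
          (∀ x : C' s.1, locq' x = 0 ↔
            (x : galoisCohomology ((W.baseChange K).torsionGaloisModule ((p ^ k : ℕ) : ℤ)) 1) ∈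
              signPart W K τ ((p ^ k : ℕ) : ℤ) (if !eb s.1 then 1 else -1)
                (selmerF W ((p ^ k : ℕ) : ℤ) 𝒯 (placesDividing K s.1)).selmerGroup) ∧
          Nat.card locq.range * Nat.card locq'.range = Nat.card Qg' ∧ IsAddCyclic Qg' ∧
          Nat.card Qg' = p ^ t) ∧
      (∀ (s : {m : ℕ // Squarefree m ∧ ∀ q ∈ m.primeFactors,
          Zhang2014.IsKolyvaginPrime (W.conductorNorm ℤ) W K p q ∧ k ≤ Zhang2014.kolyvaginIndex W p q})
        (ℓ : ℕ), Zhang2014.IsKolyvaginPrime (W.conductorNorm ℤ) W K p ℓ →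
        k ≤ Zhang2014.kolyvaginIndex W p ℓ → ¬ ℓ ∣ s.1 → (∀ q ∈ s.1.primeFactors, q < ℓ) → n ∣ s.1 →
        ∀ v : HeightOneSpectrum (𝓞 K), (ℓ : 𝓞 K) ∈ v.asIdeal →
        ∃ (Sg : Type) (_ : AddCommGroup Sg)
          (sing : signPart W K τ ((p ^ k : ℕ) : ℤ) (if !eb s.1 then 1 else -1)
              (((selmerF0 W ((p ^ k : ℕ) : ℤ) 𝒯 𝒮 (placesDividing K s.1) {v₀, τ • v₀}).relaxedAt
                {v}).selmerGroup) →+ Sg),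
          (∀ x, sing x = 0 ↔
            (x : galoisCohomology ((W.baseChange K).torsionGaloisModule ((p ^ k : ℕ) : ℤ)) 1) ∈
              signPart W K τ ((p ^ k : ℕ) : ℤ) (if !eb s.1 then 1 else -1)
                ((selmerF0 W ((p ^ k : ℕ) : ℤ) 𝒯 𝒮 (placesDividing K s.1) {v₀, τ • v₀}).selmerGroup)) ∧
          Nat.card sing.range *
            Nat.card ((C' s.1).map (galoisCohomology.localization
              ((W.baseChange K).torsionGaloisModule ((p ^ k : ℕ) : ℤ)) (Sum.inr v) 1)) = p ^ k) := by
  -- admissibility, as a predicate on `ℕ`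
  let A : ℕ → Prop := fun m ↦ Squarefree m ∧ ∀ q ∈ m.primeFactors,
    Zhang2014.IsKolyvaginPrime (W.conductorNorm ℤ) W K p q ∧ k ≤ Zhang2014.kolyvaginIndex W p q
  -- the sign at a conductor
  have hs : ∀ m : ℕ, (if !eb m then (1 : ℤ) else -1) = 1 ∨ (if !eb m then (1 : ℤ) else -1) = -1 :=
    fun m ↦ by cases eb m <;> simp
  -- the carrier pair is disjoint from the primes of an admissible conductor (prime to `N`)
  have hQc : ∀ m : ℕ, A m →
      Disjoint ({v₀, τ • v₀} : Finset (HeightOneSpectrum (𝓞 K))) (placesDividing K m) := by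
    intro m hm
    have hm0 : m ≠ 0 := hm.1.ne_zero
    have hcopN : Nat.Coprime m (W.conductorNorm ℤ) := by
      refine Nat.coprime_of_dvd fun q hq hqc hqN ↦ ?_
      exact (hm.2 q (Nat.mem_primeFactors.mpr ⟨hq, hqc, hm0⟩)).1.2.1 hqN
    rw [Finset.disjoint_left]
    intro v hv hvc
    have hcv : (m : 𝓞 K) ∈ v.asIdeal := (mem_placesDividing_iff_natCast_mem hm0 v).mp hvc
    simp only [Finset.mem_insert, Finset.mem_singleton] at hv
    rcases hv with rfl | rfl
    · exact natCast_notMem_of_coprime hcopN _ hcv hv₀N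
    · refine natCast_notMem_of_coprime hcopN _ hcv ?_
      have := (HeightOneSpectrum.smul_mem_smul_asIdeal_iff τ v₀ ((W.conductorNorm ℤ : ℕ) : 𝓞 K)).mpr hv₀N
      rwa [GlobalDuality.smul_natCast_ringOfIntegers] at this
  -- per conductor: bsd-jet's packaged duality (or `⊥` off the admissible conductors)
  have key : ∀ m : ℕ, ∃ C' : AddSubgroup
      (galoisCohomology ((W.baseChange K).torsionGaloisModule ((p ^ k : ℕ) : ℤ)) 1),
      C' ≤ signPart W K τ ((p ^ k : ℕ) : ℤ) (if !eb m then 1 else -1) ⊤ ∧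
      ∀ hm : A m,
        (∃ (Qg Qg' : Type) (_ : AddCommGroup Qg) (_ : AddCommGroup Qg') (_ : Finite Qg')
          (locq : signPart W K τ ((p ^ k : ℕ) : ℤ) (if !eb m then 1 else -1)
            (selmerF W ((p ^ k : ℕ) : ℤ) 𝒯 (placesDividing K m)).selmerGroup →+ Qg)
          (locq' : C' →+ Qg'),
          (∀ x : C', locq' x = 0 ↔
            (x : galoisCohomology ((W.baseChange K).torsionGaloisModule ((p ^ k : ℕ) : ℤ)) 1) ∈
              signPart W K τ ((p ^ k : ℕ) : ℤ) (if !eb m then 1 else -1)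
                (selmerF W ((p ^ k : ℕ) : ℤ) 𝒯 (placesDividing K m)).selmerGroup) ∧
          Nat.card locq.range * Nat.card locq'.range = Nat.card Qg' ∧ IsAddCyclic Qg' ∧
          Nat.card Qg' = p ^ t) ∧
        (∀ ℓ : ℕ, Zhang2014.IsKolyvaginPrime (W.conductorNorm ℤ) W K p ℓ →
          k ≤ Zhang2014.kolyvaginIndex W p ℓ → ℓ ∉ m.primeFactors →
          ∀ (v : HeightOneSpectrum (𝓞 K)), (ℓ : 𝓞 K) ∈ v.asIdeal →
          ∃ (Sg : Type) (_ : AddCommGroup Sg)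
            (sing : signPart W K τ ((p ^ k : ℕ) : ℤ) (if !eb m then 1 else -1)
              (((selmerF0 W ((p ^ k : ℕ) : ℤ) 𝒯 𝒮 (placesDividing K m) {v₀, τ • v₀}).relaxedAt
                {v}).selmerGroup) →+ Sg),
            (∀ x, sing x = 0 ↔
              (x : galoisCohomology ((W.baseChange K).torsionGaloisModule ((p ^ k : ℕ) : ℤ)) 1) ∈
                signPart W K τ ((p ^ k : ℕ) : ℤ) (if !eb m then 1 else -1)
                  (selmerF0 W ((p ^ k : ℕ) : ℤ) 𝒯 𝒮 (placesDividing K m) {v₀, τ • v₀}).selmerGroup) ∧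
            Nat.card sing.range *
              Nat.card (C'.map (galoisCohomology.localization
                ((W.baseChange K).torsionGaloisModule ((p ^ k : ℕ) : ℤ)) (Sum.inr v : Place K) 1)) =
              p ^ k) := by
    intro m
    by_cases hm : A m
    · obtain ⟨C', h1, h2, h3⟩ := GlobalDuality.exists_rowDuality W τ p k e hμ hadd₁ hadd₂ hgal halt
        hnondeg hτe hPT hτ hp2 hk 𝒯 𝒮 hm.1.ne_zero (h𝒯σ ⟨m, hm⟩) (h𝒯sd ⟨m, hm⟩) hS v₀ hv₀ (hQc m hm)
        h𝒮σ hcyc hidx (W.conductorNorm ℤ) hv₀N (hs m)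
        (fun ℓ hK hkℓ _ v hv hfix ↦ hloc ℓ hK hkℓ v hv hfix _ (hs m))
      exact ⟨C', h1, fun _ ↦ ⟨h2, h3⟩⟩
    · exact ⟨⊥, bot_le, fun h ↦ absurd h hm⟩
  choose C' hC hrest using key
  refine ⟨C', hC, fun s _ ↦ (hrest s.1 s.2).1, fun s ℓ hK hkℓ hℓs _ _ v hv ↦ ?_⟩
  exact (hrest s.1 s.2).2 ℓ hK hkℓ (fun h ↦ hℓs (Nat.dvd_of_mem_primeFactors h)) v hv

end Summit.BirchSwinnertonDyer.Rank1Residual.JET.Walk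

end
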